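import Literature.MathematicalPhysics.QuantumLattice.HubbardTTPrimeTorusLimitState
import Literature.MathematicalPhysics.QuantumLattice.HubbardCorrelatorCertificate
import HarnessLib

/-!
# The `t–t'` Hellmann–Feynman supergradient in the thermodynamic limit:
# a torus-limit ground state at `(t'₀, U₀)` bounds `energyDensityTT'` from above at every `(t', U)`

Family `hubbard` (topic `MathematicalPhysics/QuantumLattice`); written for the certified fast layer of
the Hubbard re-charter (crew hubbard-fast, planner TARGET §6 item T2: the thermodynamic-limit spelling of
the finite-torus supergradient `TTPrimeFree.groundEnergy_tt_le_affine` /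
`HubbardTTPrimeHoppingSupergradient.joint_le_of_bounds`, template
`InfVolFermionState.IsTorusLimitOf.energyDensity2D_sub_le_mul_re_expect_docc`). The `t–t'–U` Hubbard
interaction `Φ(t,t',U) = hubbardTTPrimeFermionInteraction t t' U` on `ℤ²` is LINEAR in the coupling
vector, hence so are its mean-energy observable `E_Φ` and the mean energy
`e_Φ(ω) = ω.meanEnergy Φ 1 = Re ω(E_Φ)` of every infinite-volume state `ω`
(`meanEnergy_hubbardTTPrime_affine`):

  `e_{Φ(t,t',U)}(ω) = e_{Φ(t,t'₀,U₀)}(ω) + (U − U₀)·e_{Φ(0,0,1)}(ω) + (t' − t'₀)·e_{Φ(0,1,0)}(ω)`,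

with the two SLOPES `e_{Φ(0,0,1)}(ω) = Re ω(n_{0↑}n_{0↓})` — the double-occupancy density
(`IsTorusLimitOf.meanEnergy_onSite_eq_re_expect_docc`) — and `e_{Φ(0,1,0)}(ω)` = the diagonal-hopping
energy per site at unit amplitude (the limit of `Re⟨ψ_L, H_L(0,1,0) ψ_L⟩/L² = -Re⟨ψ_L, T' ψ_L⟩/L²`,
`IsTorusLimitOf.tendsto_meanEnergy_hubbardTTPrime`). If `ω` is a torus limit of unit sector ground states
`ψ_L ∈ (rectN n L, S^z = 0)` of `hubbardTorusTT' L t t'₀ U₀` (`U₀ ≥ 0`, `0 ≤ n < 2`), then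
`e_{Φ(t,t'₀,U₀)}(ω) = e(t,t'₀,U₀,n)` (`IsTorusLimitOf.meanEnergy_hubbardTTPrime_eq_energyDensityTT'`, tree)
while at every other `(t', U)`, `U ≥ 0`, the variational principle on each torus gives
`e(t,t',U,n) ≤ e_{Φ(t,t',U)}(ω)` (`IsTorusLimitOf.energyDensityTT'_le_meanEnergy_hubbardTTPrime`). Hence the
**supergradient (tangent-plane) inequality**

  `e(t,t',U,n) ≤ e(t,t'₀,U₀,n) + (U − U₀)·Re ω(n_{0↑}n_{0↓}) + (t' − t'₀)·e_{Φ(0,1,0)}(ω)`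

(`IsTorusLimitOf.energyDensityTT'_le_affine`, `…_le_affine_docc`), and its certified-row corollary
`energyDensityTT'_le_of_forall_isTorusLimitOf_slopes`: if EVERY such torus-limit ground state at the anchor
has its two slopes in certified brackets and `e(t,t'₀,U₀,n) ≤ R`, then `e(t,t',U,n) ≤ R + max over the
bracket corners of the affine form` — stated quadrant-free with the four corner products (the planner's
kinds `U-tangent-upper`, `tprime-tangent-upper`, `tU-tangent-upper`). Everything is PROVED; no
definition, no named fact, no numerical input.

## Mathlib / tree search

REUSED: `hubbardTTPrimeFermionInteraction` (+ `_apply`), `FermionInteraction.meanEnergyObs_of_add`,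
`InfVolFermionState.meanEnergy`, `IsTorusLimitOf`, `torusAvgExpect_hubbardTTPrime_meanEnergyObs`,
`IsTorusLimitOf.meanEnergy_hubbardTTPrime_eq_energyDensityTT'`,
`exists_isTorusLimitOf_squareGroundStatesTT'_meanEnergy_eq`, `torusAvgExpect_docc`,
`tendsto_energyDensityTT'_torus`, `LiebThm1.groundEnergy_le_re_expect`, `mem_szSector_iff`.
`lean search 'meanEnergy.*affine|energyDensityTT._le_affine|supergradient'` in Literature: finite-torus
forms only (`HubbardTTPrimeHoppingSupergradient`, `HubbardTTPrimeFreeKineticBound` §4) and the `t' = 0`,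
`U`-only thermodynamic-limit form (`HubbardCorrelatorCertificate` §EnergyFromDocc).

## References

* T. Koma, H. Tasaki, J. Stat. Phys. 76 (1994) 745, §1 (the ground-state energy is concave in a
  coupling multiplying a term of the Hamiltonian; the conjugate observable is a supergradient).
  [cite: KomaTasaki1994, §1]
* R. B. Griffiths, Phys. Rev. 152 (1966) 240, §II–III (one-sided derivatives of the energy bound the
  order parameter of every ground state). [cite: Griffiths1966, §II]
* O. Bratteli, A. Kishimoto, D. W. Robinson, Commun. Math. Phys. 64 (1978) 41, §3 (mean energy
  functional of translation-invariant states; linear in the interaction). [cite: BratteliKishimotoRobinson1978, §3 (mean energy functional)]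
* D. Ruelle, *Statistical Mechanics* (1969), §3.3–§3.4 (thermodynamic limit of the ground-state
  energy density). [cite: Ruelle1969, §3.4]
* H. Xu et al., Science 384 (2024) eadh7691, eq. (1) (the `t–t'–U` family). [cite: XuEtAl2024, eq. (1)]
-/

noncomputable section

namespace Literature.MathematicalPhysics.QuantumLattice

open Matrix Finset HubbardWave0 Literature.Probability.LatticeModels ThermodynamicLimit
open _root_.Filter
open scoped _root_.Topology ComplexOrder BigOperators

/-! ### §1 The `t–t'–U` interaction is linear in the couplings -/

section IteSmul

variable {M : Type*} [AddCommGroup M] [Module ℂ M] (p : Prop) [Decidable p]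

/-- `if p then (a + b) • v else 0` splits. [folklore] -/
private theorem ite_add_smul_eq (a b : ℂ) (v : M) :
    (if p then (a + b) • v else 0) = (if p then a • v else 0) + (if p then b • v else 0) := by
  split_ifs <;> simp [add_smul]

/-- `if p then (c * a) • v else 0 = c • (if p then a • v else 0)`. [folklore] -/
private theorem ite_mul_smul_eq (c a : ℂ) (v : M) :
    (if p then (c * a) • v else 0) = c • (if p then a • v else 0) := by
  split_ifs <;> simp [mul_smul]

/-- `if p then (-(c * a)) • v else 0 = c • (if p then (-a) • v else 0)`. [folklore] -/
private theorem ite_neg_mul_smul_eq (c a : ℂ) (v : M) :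
    (if p then (-(c * a)) • v else 0) = c • (if p then (-a) • v else 0) := by
  split_ifs <;> simp [mul_smul]

end IteSmul

/-- **Additivity of the nearest-neighbour Hubbard interaction in `(t, U)`.** [cite: XuEtAl2024, eq. (1)] -/
theorem hubbardFermionInteraction_add {d : ℕ} (t₁ t₂ U₁ U₂ : ℝ) (X : Finset (Site d)) :
    (hubbardFermionInteraction d (t₁ + t₂) (U₁ + U₂)).Φ X =
      (hubbardFermionInteraction d t₁ U₁).Φ X + (hubbardFermionInteraction d t₂ U₂).Φ X := by
  simp only [hubbardFermionInteraction, Complex.ofReal_add, neg_add, ite_add_smul_eq,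
    Finset.sum_add_distrib]
  abel

/-- **Homogeneity of the nearest-neighbour Hubbard interaction in `(t, U)`.** [cite: XuEtAl2024, eq. (1)] -/
theorem hubbardFermionInteraction_smul {d : ℕ} (c t U : ℝ) (X : Finset (Site d)) :
    (hubbardFermionInteraction d (c * t) (c * U)).Φ X = (c : ℂ) • (hubbardFermionInteraction d t U).Φ X := by
  simp only [hubbardFermionInteraction, Complex.ofReal_mul, ite_mul_smul_eq, ite_neg_mul_smul_eq,
    ← Finset.smul_sum, ← smul_add]

/-- **Additivity of the diagonal hopping interaction in `t'`.** [cite: XuEtAl2024, eq. (1)] -/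
theorem diagHoppingFermionInteraction_add (t'₁ t'₂ : ℝ) (X : Finset (Site 2)) :
    (diagHoppingFermionInteraction (t'₁ + t'₂)).Φ X =
      (diagHoppingFermionInteraction t'₁).Φ X + (diagHoppingFermionInteraction t'₂).Φ X := by
  simp only [diagHoppingFermionInteraction, Complex.ofReal_add, neg_add, ite_add_smul_eq,
    Finset.sum_add_distrib]

/-- **Homogeneity of the diagonal hopping interaction in `t'`.** [cite: XuEtAl2024, eq. (1)] -/
theorem diagHoppingFermionInteraction_smul (c t' : ℝ) (X : Finset (Site 2)) :
    (diagHoppingFermionInteraction (c * t')).Φ X = (c : ℂ) • (diagHoppingFermionInteraction t').Φ X := by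
  simp only [diagHoppingFermionInteraction, Complex.ofReal_mul, ite_neg_mul_smul_eq, ← Finset.smul_sum]

/-- **The `t–t'–U` interaction is additive in the coupling vector**:
`Φ(t₁+t₂, t'₁+t'₂, U₁+U₂) X = Φ(t₁,t'₁,U₁) X + Φ(t₂,t'₂,U₂) X`. [cite: XuEtAl2024, eq. (1)] -/
theorem hubbardTTPrimeFermionInteraction_add (t₁ t₂ t'₁ t'₂ U₁ U₂ : ℝ) (X : Finset (Site 2)) :
    (hubbardTTPrimeFermionInteraction (t₁ + t₂) (t'₁ + t'₂) (U₁ + U₂)).Φ X =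
      (hubbardTTPrimeFermionInteraction t₁ t'₁ U₁).Φ X +
        (hubbardTTPrimeFermionInteraction t₂ t'₂ U₂).Φ X := by
  rw [hubbardTTPrimeFermionInteraction_apply, hubbardTTPrimeFermionInteraction_apply,
    hubbardTTPrimeFermionInteraction_apply, hubbardFermionInteraction_add,
    diagHoppingFermionInteraction_add]
  abel

/-- **The `t–t'–U` interaction is homogeneous in the coupling vector**:
`Φ(ct, ct', cU) X = c • Φ(t,t',U) X`. [cite: XuEtAl2024, eq. (1)] -/
theorem hubbardTTPrimeFermionInteraction_smul (c t t' U : ℝ) (X : Finset (Site 2)) :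
    (hubbardTTPrimeFermionInteraction (c * t) (c * t') (c * U)).Φ X =
      (c : ℂ) • (hubbardTTPrimeFermionInteraction t t' U).Φ X := by
  rw [hubbardTTPrimeFermionInteraction_apply, hubbardTTPrimeFermionInteraction_apply,
    hubbardFermionInteraction_smul, diagHoppingFermionInteraction_smul, smul_add]

namespace FermionInteraction

/-- The mean-energy observable of a pointwise scalar multiple of an interaction is the scalar
multiple of the mean-energy observable. [cite: BratteliKishimotoRobinson1978, §3 (mean energy functional)] -/
theorem meanEnergyObs_of_smul {d : ℕ} {Ψ Ψ₁ : FermionInteraction d} {c : ℂ}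
    (h : ∀ X, Ψ.Φ X = c • Ψ₁.Φ X) (R : ℝ) : Ψ.meanEnergyObs R = c • Ψ₁.meanEnergyObs R := by
  unfold meanEnergyObs
  rw [Finset.smul_sum]
  exact Finset.sum_congr rfl fun X _ => by rw [h, map_smul, smul_comm]

end FermionInteraction

namespace InfVolFermionState

variable (ω : InfVolFermionState 2)

/-- **The `t–t'` mean energy is additive in the couplings**:
`e_{Φ(t₁+t₂,t'₁+t'₂,U₁+U₂)}(ω) = e_{Φ(t₁,t'₁,U₁)}(ω) + e_{Φ(t₂,t'₂,U₂)}(ω)` for every infinite-volume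
state `ω`. [cite: BratteliKishimotoRobinson1978, §3 (mean energy functional)] -/
theorem meanEnergy_hubbardTTPrime_add (t₁ t₂ t'₁ t'₂ U₁ U₂ : ℝ) :
    ω.meanEnergy (hubbardTTPrimeFermionInteraction (t₁ + t₂) (t'₁ + t'₂) (U₁ + U₂)) 1 =
      ω.meanEnergy (hubbardTTPrimeFermionInteraction t₁ t'₁ U₁) 1 +
        ω.meanEnergy (hubbardTTPrimeFermionInteraction t₂ t'₂ U₂) 1 := by
  unfold InfVolFermionState.meanEnergy
  rw [FermionInteraction.meanEnergyObs_of_add (hubbardTTPrimeFermionInteraction_add t₁ t₂ t'₁ t'₂ U₁ U₂),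
    map_add, Complex.add_re]

/-- **The `t–t'` mean energy is homogeneous in the couplings**:
`e_{Φ(ct,ct',cU)}(ω) = c · e_{Φ(t,t',U)}(ω)`. [cite: BratteliKishimotoRobinson1978, §3 (mean energy functional)] -/
theorem meanEnergy_hubbardTTPrime_smul (c t t' U : ℝ) :
    ω.meanEnergy (hubbardTTPrimeFermionInteraction (c * t) (c * t') (c * U)) 1 =
      c * ω.meanEnergy (hubbardTTPrimeFermionInteraction t t' U) 1 := by
  unfold InfVolFermionState.meanEnergy
  rw [FermionInteraction.meanEnergyObs_of_smul (hubbardTTPrimeFermionInteraction_smul c t t' U),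
    map_smul, smul_eq_mul, Complex.re_ofReal_mul]

/-- **The `t–t'` mean energy is affine in `(t', U)` with two state-dependent slopes**: for every
infinite-volume state `ω` and all `t, t'₀, U₀, t', U`,
`e_{Φ(t,t',U)}(ω) = e_{Φ(t,t'₀,U₀)}(ω) + (U − U₀)·e_{Φ(0,0,1)}(ω) + (t' − t'₀)·e_{Φ(0,1,0)}(ω)` — the
slopes are the double-occupancy density and the unit-amplitude diagonal-hopping energy per site of `ω`.
[cite: BratteliKishimotoRobinson1978, §3 (mean energy functional)] -/
theorem meanEnergy_hubbardTTPrime_affine (t t'₀ U₀ t' U : ℝ) :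
    ω.meanEnergy (hubbardTTPrimeFermionInteraction t t' U) 1 =
      ω.meanEnergy (hubbardTTPrimeFermionInteraction t t'₀ U₀) 1 +
        (U - U₀) * ω.meanEnergy (hubbardTTPrimeFermionInteraction 0 0 1) 1 +
          (t' - t'₀) * ω.meanEnergy (hubbardTTPrimeFermionInteraction 0 1 0) 1 := by
  have h1 : ω.meanEnergy (hubbardTTPrimeFermionInteraction t t' U) 1 =
      ω.meanEnergy (hubbardTTPrimeFermionInteraction (t + 0) (t'₀ + (t' - t'₀)) (U₀ + (U - U₀))) 1 := by
    rw [add_zero, add_sub_cancel, add_sub_cancel]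
  have h2 : ω.meanEnergy (hubbardTTPrimeFermionInteraction 0 (t' - t'₀) (U - U₀)) 1 =
      ω.meanEnergy (hubbardTTPrimeFermionInteraction (0 + 0) (0 + (t' - t'₀)) ((U - U₀) + 0)) 1 := by
    rw [add_zero, zero_add, add_zero]
  have hU : ω.meanEnergy (hubbardTTPrimeFermionInteraction 0 0 (U - U₀)) 1 =
      (U - U₀) * ω.meanEnergy (hubbardTTPrimeFermionInteraction 0 0 1) 1 := by
    have h := ω.meanEnergy_hubbardTTPrime_smul (U - U₀) 0 0 1
    rwa [mul_zero, mul_one] at h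
  have ht' : ω.meanEnergy (hubbardTTPrimeFermionInteraction 0 (t' - t'₀) 0) 1 =
      (t' - t'₀) * ω.meanEnergy (hubbardTTPrimeFermionInteraction 0 1 0) 1 := by
    have h := ω.meanEnergy_hubbardTTPrime_smul (t' - t'₀) 0 1 0
    rwa [mul_zero, mul_one] at h
  rw [h1, meanEnergy_hubbardTTPrime_add, h2, meanEnergy_hubbardTTPrime_add, hU, ht']
  ring

/-! ### §2 Torus limits: the mean energy at every coupling, and the on-site slope -/

/-- **The `t–t'` mean energy of a torus limit is the limit of the energies per site at EVERY
coupling**: if `ω` is the torus limit of unit vectors `ψ` along `Ls → ∞`, then for all `t, t', U`,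
`Re⟨ψ_j, H_{Ls j}(t,t',U) ψ_j⟩/(Ls j)² → e_{Φ(t,t',U)}(ω)` (the translates of `E_Φ` sum to the torus
Hamiltonian, `torusAvgExpect_hubbardTTPrime_meanEnergyObs`). [cite: BratteliKishimotoRobinson1978, §3 (mean energy functional)] -/
theorem IsTorusLimitOf.tendsto_meanEnergy_hubbardTTPrime (t t' U : ℝ)
    {ω : InfVolFermionState 2} {ψ : ∀ L, Fock (Orb (FermionTorus 2 L))} {Ls : ℕ → ℕ}
    (h : ω.IsTorusLimitOf ψ Ls) (hLs : Tendsto Ls atTop atTop) :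
    Tendsto (fun j => (star (ψ (Ls j)) ⬝ᵥ (hubbardTorusTT' (Ls j) t t' U *ᵥ ψ (Ls j))).re /
      (Ls j : ℝ) ^ 2) atTop (𝓝 (ω.meanEnergy (hubbardTTPrimeFermionInteraction t t' U) 1)) := by
  have hc := (Complex.continuous_re.tendsto _).comp
    (h (thicken ({0} : Finset (Site 2)) 1) ((hubbardTTPrimeFermionInteraction t t' U).meanEnergyObs 1))
  refine hc.congr' ?_
  filter_upwards [hLs.eventually_ge_atTop 3] with j hj
  rw [Function.comp_apply, torusAvgExpect_hubbardTTPrime_meanEnergyObs t t' U hj,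
    ← Complex.ofReal_natCast, ← Complex.ofReal_pow, Complex.div_ofReal_re]
  rfl

/-- **The variational inequality at every coupling.** If `ω` is the torus limit along `Ls → ∞` of
unit `rectN n (Ls j)`-particle vectors `ψ_j` (ground states or not), then for `U ≥ 0`, `0 ≤ n < 2`
and all `t, t'`: `e(t,t',U,n) ≤ e_{Φ(t,t',U)}(ω)` — each `ψ_j` is a trial state for
`E_{rectN n (Ls j)}(t,t',U)`, and both sides converge. [cite: Ruelle1969, §3.4] -/
theorem IsTorusLimitOf.energyDensityTT'_le_meanEnergy_hubbardTTPrime (t t' : ℝ) {U : ℝ} (hU : 0 ≤ U)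
    {n : ℝ} (hn0 : 0 ≤ n) (hn2 : n < 2)
    {ω : InfVolFermionState 2} {ψ : ∀ L, Fock (Orb (FermionTorus 2 L))} {Ls : ℕ → ℕ}
    (h : ω.IsTorusLimitOf ψ Ls) (hLs : Tendsto Ls atTop atTop)
    (hN : ∀ j, IsNParticle (rectN n (Ls j)) (ψ (Ls j)))
    (h1 : ∀ j, star (ψ (Ls j)) ⬝ᵥ ψ (Ls j) = 1) :
    energyDensityTT' t t' U n ≤ ω.meanEnergy (hubbardTTPrimeFermionInteraction t t' U) 1 := by
  have he := (tendsto_energyDensityTT'_torus t t' hU hn0 hn2).comp hLs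
  refine le_of_tendsto_of_tendsto' he (h.tendsto_meanEnergy_hubbardTTPrime t t' U hLs) fun j => ?_
  simp only [Function.comp_apply]
  exact div_le_div_of_nonneg_right
    (LiebThm1.groundEnergy_le_re_expect (hubbardTorusTT' (Ls j) t t' U) (hN j) (h1 j)) (sq_nonneg _)

/-- The pure on-site interaction at unit strength is the total double occupancy:
`H_L(0, 0, 1) = Σ_x n_{x↑} n_{x↓}`. [cite: XuEtAl2024, eq. (1)] -/
theorem hubbardTorusTT'_zero_zero_one (L : ℕ) :
    hubbardTorusTT' L 0 0 1 = ∑ x : FermionTorus 2 L, numberOp x 0 * numberOp x 1 := by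
  simp [hubbardTorusTT', hamiltonian]

/-- **The on-site slope of a torus limit is its double-occupancy density**:
`e_{Φ(0,0,1)}(ω) = Re ω(n_{0↑} n_{0↓})`. [cite: KomaTasaki1994, §1] -/
theorem IsTorusLimitOf.meanEnergy_onSite_eq_re_expect_docc
    {ω : InfVolFermionState 2} {ψ : ∀ L, Fock (Orb (FermionTorus 2 L))} {Ls : ℕ → ℕ}
    (h : ω.IsTorusLimitOf ψ Ls) (hLs : Tendsto Ls atTop atTop) :
    ω.meanEnergy (hubbardTTPrimeFermionInteraction 0 0 1) 1 =
      (ω.expect ({0} : Finset (Site 2))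
        (nAt 0 (Finset.mem_singleton_self 0) 0 * nAt 0 (Finset.mem_singleton_self 0) 1)).re := by
  have hE := h.tendsto_meanEnergy_hubbardTTPrime 0 0 1 hLs
  have hD := (Complex.continuous_re.tendsto _).comp
    (h ({0} : Finset (Site 2)) (nAt 0 (Finset.mem_singleton_self 0) 0 * nAt 0 (Finset.mem_singleton_self 0) 1))
  refine tendsto_nhds_unique hE (hD.congr' ?_)
  filter_upwards [hLs.eventually_ge_atTop 1] with j hj
  haveI : NeZero (Ls j) := ⟨by omega⟩
  rw [Function.comp_apply, torusAvgExpect_docc, hubbardTorusTT'_zero_zero_one, ← Complex.ofReal_natCast,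
    ← Complex.ofReal_pow, ← Complex.ofReal_inv, Complex.re_ofReal_mul, inv_mul_eq_div]
  rfl

/-! ### §3 The supergradient inequality -/

/-- **Hellmann–Feynman supergradient in the thermodynamic limit (`t–t'–U`).** Let `ω` be a torus limit
along `Ls → ∞` of unit ground states `ψ_j` of `hubbardTorusTT' (Ls j) t t'₀ U₀` in the sectors
`(rectN n (Ls j), S^z = 0)`, `U₀ ≥ 0`, `0 ≤ n < 2`. Then for every `t'` and every `U ≥ 0`:
`e(t,t',U,n) ≤ e(t,t'₀,U₀,n) + (U − U₀)·e_{Φ(0,0,1)}(ω) + (t' − t'₀)·e_{Φ(0,1,0)}(ω)`.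
[cite: KomaTasaki1994, §1] -/
theorem IsTorusLimitOf.energyDensityTT'_le_affine (t t'₀ : ℝ) {U₀ : ℝ} (hU₀ : 0 ≤ U₀) {n : ℝ}
    (hn0 : 0 ≤ n) (hn2 : n < 2)
    {ω : InfVolFermionState 2} {ψ : ∀ L, Fock (Orb (FermionTorus 2 L))} {Ls : ℕ → ℕ}
    (h : ω.IsTorusLimitOf ψ Ls) (hLs : Tendsto Ls atTop atTop)
    (hψ : ∀ j, IsGroundStateInSector (hubbardTorusTT' (Ls j) t t'₀ U₀) (rectN n (Ls j)) 0 (ψ (Ls j)))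
    (h1 : ∀ j, star (ψ (Ls j)) ⬝ᵥ ψ (Ls j) = 1) (t' : ℝ) {U : ℝ} (hU : 0 ≤ U) :
    energyDensityTT' t t' U n ≤
      energyDensityTT' t t'₀ U₀ n +
        (U - U₀) * ω.meanEnergy (hubbardTTPrimeFermionInteraction 0 0 1) 1 +
          (t' - t'₀) * ω.meanEnergy (hubbardTTPrimeFermionInteraction 0 1 0) 1 := by
  have hN : ∀ j, IsNParticle (rectN n (Ls j)) (ψ (Ls j)) := fun j =>
    ((mem_szSector_iff _ _ _).1 (hψ j).1).1
  have hvar := h.energyDensityTT'_le_meanEnergy_hubbardTTPrime t t' hU hn0 hn2 hLs hN h1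
  rw [ω.meanEnergy_hubbardTTPrime_affine t t'₀ U₀ t' U,
    h.meanEnergy_hubbardTTPrime_eq_energyDensityTT' t t'₀ hU₀ hn0 hn2 hLs hψ h1] at hvar
  exact hvar

/-- The same with the on-site slope written as the double-occupancy density `Re ω(n_{0↑}n_{0↓})`.
[cite: KomaTasaki1994, §1] -/
theorem IsTorusLimitOf.energyDensityTT'_le_affine_docc (t t'₀ : ℝ) {U₀ : ℝ} (hU₀ : 0 ≤ U₀) {n : ℝ}
    (hn0 : 0 ≤ n) (hn2 : n < 2)
    {ω : InfVolFermionState 2} {ψ : ∀ L, Fock (Orb (FermionTorus 2 L))} {Ls : ℕ → ℕ}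
    (h : ω.IsTorusLimitOf ψ Ls) (hLs : Tendsto Ls atTop atTop)
    (hψ : ∀ j, IsGroundStateInSector (hubbardTorusTT' (Ls j) t t'₀ U₀) (rectN n (Ls j)) 0 (ψ (Ls j)))
    (h1 : ∀ j, star (ψ (Ls j)) ⬝ᵥ ψ (Ls j) = 1) (t' : ℝ) {U : ℝ} (hU : 0 ≤ U) :
    energyDensityTT' t t' U n ≤
      energyDensityTT' t t'₀ U₀ n +
        (U - U₀) * (ω.expect ({0} : Finset (Site 2))
          (nAt 0 (Finset.mem_singleton_self 0) 0 * nAt 0 (Finset.mem_singleton_self 0) 1)).re +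
          (t' - t'₀) * ω.meanEnergy (hubbardTTPrimeFermionInteraction 0 1 0) 1 := by
  rw [← h.meanEnergy_onSite_eq_re_expect_docc hLs]
  exact h.energyDensityTT'_le_affine t t'₀ hU₀ hn0 hn2 hLs hψ h1 t' hU

/-- **The `U`-direction alone** (the `t' ≠ 0` twin of `energyDensity2D_sub_le_mul_re_expect_docc`):
`e(t,t'₀,U,n) − e(t,t'₀,U₀,n) ≤ (U − U₀)·Re ω(n_{0↑}n_{0↓})` for all `U ≥ 0`. [cite: KomaTasaki1994, §1] -/
theorem IsTorusLimitOf.energyDensityTT'_sub_le_mul_re_expect_docc (t t'₀ : ℝ) {U₀ : ℝ} (hU₀ : 0 ≤ U₀)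
    {n : ℝ} (hn0 : 0 ≤ n) (hn2 : n < 2)
    {ω : InfVolFermionState 2} {ψ : ∀ L, Fock (Orb (FermionTorus 2 L))} {Ls : ℕ → ℕ}
    (h : ω.IsTorusLimitOf ψ Ls) (hLs : Tendsto Ls atTop atTop)
    (hψ : ∀ j, IsGroundStateInSector (hubbardTorusTT' (Ls j) t t'₀ U₀) (rectN n (Ls j)) 0 (ψ (Ls j)))
    (h1 : ∀ j, star (ψ (Ls j)) ⬝ᵥ ψ (Ls j) = 1) {U : ℝ} (hU : 0 ≤ U) :
    energyDensityTT' t t'₀ U n - energyDensityTT' t t'₀ U₀ n ≤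
      (U - U₀) * (ω.expect ({0} : Finset (Site 2))
        (nAt 0 (Finset.mem_singleton_self 0) 0 * nAt 0 (Finset.mem_singleton_self 0) 1)).re := by
  have h' := h.energyDensityTT'_le_affine_docc t t'₀ hU₀ hn0 hn2 hLs hψ h1 t'₀ hU
  rw [sub_self, zero_mul, add_zero] at h'
  linarith

/-- **The `t'`-direction alone**: `e(t,t',U₀,n) − e(t,t'₀,U₀,n) ≤ (t' − t'₀)·e_{Φ(0,1,0)}(ω)` for
all `t'`. [cite: KomaTasaki1994, §1] -/
theorem IsTorusLimitOf.energyDensityTT'_sub_le_mul_meanEnergy_diag (t t'₀ : ℝ) {U₀ : ℝ} (hU₀ : 0 ≤ U₀)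
    {n : ℝ} (hn0 : 0 ≤ n) (hn2 : n < 2)
    {ω : InfVolFermionState 2} {ψ : ∀ L, Fock (Orb (FermionTorus 2 L))} {Ls : ℕ → ℕ}
    (h : ω.IsTorusLimitOf ψ Ls) (hLs : Tendsto Ls atTop atTop)
    (hψ : ∀ j, IsGroundStateInSector (hubbardTorusTT' (Ls j) t t'₀ U₀) (rectN n (Ls j)) 0 (ψ (Ls j)))
    (h1 : ∀ j, star (ψ (Ls j)) ⬝ᵥ ψ (Ls j) = 1) (t' : ℝ) :
    energyDensityTT' t t' U₀ n - energyDensityTT' t t'₀ U₀ n ≤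
      (t' - t'₀) * ω.meanEnergy (hubbardTTPrimeFermionInteraction 0 1 0) 1 := by
  have h' := h.energyDensityTT'_le_affine t t'₀ hU₀ hn0 hn2 hLs hψ h1 t' hU₀
  rw [sub_self, zero_mul, add_zero] at h'
  linarith

end InfVolFermionState

/-! ### §4 Certified-row form: slope brackets valid for every torus-limit ground state at the anchor -/

namespace ThermodynamicLimit

open InfVolFermionState

/-- **Tangent-plane UPPER bound from certified slope brackets.** Fix an anchor `(t'₀, U₀)`, `U₀ ≥ 0`,
a density `0 ≤ n < 2`, and a certified upper bound `e(t,t'₀,U₀,n) ≤ R`. Suppose EVERY torus-limit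
ground state `ω` at the anchor (torus limit along some `Ls → ∞` of unit `(rectN n (Ls j), S^z = 0)`
sector ground states of `hubbardTorusTT' (Ls j) t t'₀ U₀` — the hypothesis class of the `t–t'`
correlator certificates) has its double-occupancy density in `[dlo, dhi]` and its unit diagonal-hopping
mean energy `e_{Φ(0,1,0)}(ω)` in `[τlo, τhi]`. Then for every `t'` and every `U ≥ 0`:
`e(t,t',U,n) ≤ R + max((U−U₀)dlo, (U−U₀)dhi) + max((t'−t'₀)τlo, (t'−t'₀)τhi)` — the tangent plane
at the anchor with each slope taken at the unfavourable end of its bracket (one torus-limit ground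
state exists, `exists_isTorusLimitOf_squareGroundStatesTT'_meanEnergy_eq`). [cite: KomaTasaki1994, §1] -/
theorem energyDensityTT'_le_of_forall_isTorusLimitOf_slopes (t t'₀ : ℝ) {U₀ : ℝ} (hU₀ : 0 ≤ U₀)
    {n : ℝ} (hn0 : 0 ≤ n) (hn2 : n < 2) {R dlo dhi τlo τhi : ℝ}
    (hR : energyDensityTT' t t'₀ U₀ n ≤ R)
    (hslopes : ∀ (ω : InfVolFermionState 2) (Ls : ℕ → ℕ) (ψ : ∀ L, Fock (Orb (FermionTorus 2 L))),
      Tendsto Ls atTop atTop →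
      (∀ j, IsGroundStateInSector (hubbardTorusTT' (Ls j) t t'₀ U₀) (rectN n (Ls j)) 0 (ψ (Ls j))) →
      (∀ j, star (ψ (Ls j)) ⬝ᵥ ψ (Ls j) = 1) → ω.IsTorusLimitOf ψ Ls →
      dlo ≤ (ω.expect ({0} : Finset (Site 2))
          (nAt 0 (Finset.mem_singleton_self 0) 0 * nAt 0 (Finset.mem_singleton_self 0) 1)).re ∧
        (ω.expect ({0} : Finset (Site 2))
          (nAt 0 (Finset.mem_singleton_self 0) 0 * nAt 0 (Finset.mem_singleton_self 0) 1)).re ≤ dhi ∧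
        τlo ≤ ω.meanEnergy (hubbardTTPrimeFermionInteraction 0 1 0) 1 ∧
        ω.meanEnergy (hubbardTTPrimeFermionInteraction 0 1 0) 1 ≤ τhi)
    (t' : ℝ) {U : ℝ} (hU : 0 ≤ U) :
    energyDensityTT' t t' U n ≤
      R + max ((U - U₀) * dlo) ((U - U₀) * dhi) + max ((t' - t'₀) * τlo) ((t' - t'₀) * τhi) := by
  obtain ⟨ψ, Ls, ω, hLs, hω, -, -, h1, hψ, -, -, -⟩ :=
    exists_isTorusLimitOf_squareGroundStatesTT'_meanEnergy_eq t t'₀ hU₀ hn0 hn2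
  obtain ⟨hdlo, hdhi, hτlo, hτhi⟩ := hslopes ω Ls ψ hLs hψ h1 hω
  have hb := hω.energyDensityTT'_le_affine_docc t t'₀ hU₀ hn0 hn2 hLs hψ h1 t' hU
  set d := (ω.expect ({0} : Finset (Site 2))
    (nAt 0 (Finset.mem_singleton_self 0) 0 * nAt 0 (Finset.mem_singleton_self 0) 1)).re with hd
  set τ := ω.meanEnergy (hubbardTTPrimeFermionInteraction 0 1 0) 1 with hτ
  -- each slope term is bounded by the unfavourable end of its bracket
  have hD : (U - U₀) * d ≤ max ((U - U₀) * dlo) ((U - U₀) * dhi) := by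
    rcases le_total 0 (U - U₀) with hp | hm
    · exact (mul_le_mul_of_nonneg_left hdhi hp).trans (le_max_right _ _)
    · exact (mul_le_mul_of_nonpos_left hdlo hm).trans (le_max_left _ _)
  have hT : (t' - t'₀) * τ ≤ max ((t' - t'₀) * τlo) ((t' - t'₀) * τhi) := by
    rcases le_total 0 (t' - t'₀) with hp | hm
    · exact (mul_le_mul_of_nonneg_left hτhi hp).trans (le_max_right _ _)
    · exact (mul_le_mul_of_nonpos_left hτlo hm).trans (le_max_left _ _)
  linarith

/-- **`U`-tangent upper bound** (same hypothesis package, `t' = t'₀`): for `U ≥ U₀`,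
`e(t,t'₀,U,n) ≤ R + (U − U₀)·dhi`; for `0 ≤ U ≤ U₀`, `e(t,t'₀,U,n) ≤ R − (U₀ − U)·dlo`.
[cite: KomaTasaki1994, §1] -/
theorem energyDensityTT'_le_of_forall_isTorusLimitOf_docc (t t'₀ : ℝ) {U₀ : ℝ} (hU₀ : 0 ≤ U₀)
    {n : ℝ} (hn0 : 0 ≤ n) (hn2 : n < 2) {R dlo dhi : ℝ}
    (hR : energyDensityTT' t t'₀ U₀ n ≤ R)
    (hdocc : ∀ (ω : InfVolFermionState 2) (Ls : ℕ → ℕ) (ψ : ∀ L, Fock (Orb (FermionTorus 2 L))),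
      Tendsto Ls atTop atTop →
      (∀ j, IsGroundStateInSector (hubbardTorusTT' (Ls j) t t'₀ U₀) (rectN n (Ls j)) 0 (ψ (Ls j))) →
      (∀ j, star (ψ (Ls j)) ⬝ᵥ ψ (Ls j) = 1) → ω.IsTorusLimitOf ψ Ls →
      dlo ≤ (ω.expect ({0} : Finset (Site 2))
          (nAt 0 (Finset.mem_singleton_self 0) 0 * nAt 0 (Finset.mem_singleton_self 0) 1)).re ∧
        (ω.expect ({0} : Finset (Site 2))
          (nAt 0 (Finset.mem_singleton_self 0) 0 * nAt 0 (Finset.mem_singleton_self 0) 1)).re ≤ dhi)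
    {U : ℝ} (hU : 0 ≤ U) :
    energyDensityTT' t t'₀ U n ≤ R + max ((U - U₀) * dlo) ((U - U₀) * dhi) := by
  obtain ⟨ψ, Ls, ω, hLs, hω, -, -, h1, hψ, -, -, -⟩ :=
    exists_isTorusLimitOf_squareGroundStatesTT'_meanEnergy_eq t t'₀ hU₀ hn0 hn2
  obtain ⟨hdlo, hdhi⟩ := hdocc ω Ls ψ hLs hψ h1 hω
  have hb := hω.energyDensityTT'_sub_le_mul_re_expect_docc t t'₀ hU₀ hn0 hn2 hLs hψ h1 hU
  set d := (ω.expect ({0} : Finset (Site 2))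
    (nAt 0 (Finset.mem_singleton_self 0) 0 * nAt 0 (Finset.mem_singleton_self 0) 1)).re with hd
  have hD : (U - U₀) * d ≤ max ((U - U₀) * dlo) ((U - U₀) * dhi) := by
    rcases le_total 0 (U - U₀) with hp | hm
    · exact (mul_le_mul_of_nonneg_left hdhi hp).trans (le_max_right _ _)
    · exact (mul_le_mul_of_nonpos_left hdlo hm).trans (le_max_left _ _)
  linarith

end ThermodynamicLimit

end Literature.MathematicalPhysics.QuantumLattice

end
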